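import Summits.QuantumFields.BalabanUV.T4Continuum.Support.GradedWellMassCommutator
import Summits.QuantumFields.BalabanUV.T4Continuum.Support.GradedWellColumnsTwoLevel
import Summits.QuantumFields.BalabanUV.T4Continuum.Support.GradedWellSandwichLaw
import Summits.QuantumFields.BalabanUV.T4Continuum.Support.GradedWellTowerCoercive
import Summits.QuantumFields.BalabanUV.T4Continuum.Support.GradedWellDifference
import Summits.QuantumFields.BalabanUV.T4Continuum.Support.OutputRateTowerInstance

/-!
# T⁴ programme, spine node NE2 (U1a), sub-row Δ1 — THE GRADED-WELL TOWER END WITH NO DISPLAYED BINDER: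
# `towerLimitRate_GW (ha) (hd : 1 ≤ d) (hL : 2 ≤ L) (hlay : layer ≤ m) (ha′) : TowerLimitRate (Qlev (m+·)) L^d (k ↦ G_GW(m+k)) (Cpert …) L⁻¹`

Cell `pub-balaban-gaps` (YM blitz, track G2, seat ne2 = spine estimate NE2).  The Δ1 «graded well» END of record of the parked NE2 lineage,
`GradedWellSandwichLaw.towerLimitRate_GW_of_GWB` (leaf-06-g8; owner rulings R47–R52; `t4/T4-EST-NE2-D1-GW-SPEC.md` v1.1 §5), displayed four inputs:
`hco` (coercivity — (GW-W1)+(GW-S0), THEOREM `GradedWellTowerCoercive.hco_GW`), `hE` (`‖E_GW‖ ≤ e`, THEOREM `GradedWellDifference.opNorm_EGW_le`),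
`hMc` ((E4), THEOREM `GradedWellMassCommutator.hMc_GW`, this seat) and `hB` ((GW-B), THEOREM `GradedWellColumnsTwoLevel.hB_GW`, this seat on the
owner's `TorusColumnsTwoLevel`).  THIS FILE is the junction ([folklore] bookkeeping, four applications):
 * §1 **`hEc_GW`** — the 𝒢-sandwiched two-level law of `E_GW = Δ_a − Δ_GW` with NO displayed binder (`cons_EGW_tower` ∘ `hMc_GW` ∘ `hSc_of_GWB` ∘ `hB_GW`);
 * §2 **`towerLimitRate_GW`** — the graded-well tower converges at the TORUS RATE `L⁻¹` for ANY layer map `layer : Tor M → ℕ` with `layer ≤ m`,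
   constants depending on `d, L, m, a, a′` only; `freeTowerLaws_GW` (the `hfree` input of node NE5's W1 socket `OutputRateTowerInstance.towerLaw_perturbed`,
   no binder); `towerLimitRate_GW_rate` (any `θ ∈ [L⁻¹, 1)`); `towerLimitRate_GW_perturbed` (the resolvent route over the graded well for any
   `PerturbationLaws` family — the socket for a background perturbation restricted to the graded geometry);
 * §3 **`towerLaw_GW_perturbed`** — the graded-well tower in node NE5's W1 socket `OutputRateTowerSocket.TowerLaw` (Δ1 analogue of the B7 × NE5
   junction `OutputRateTowerBalaban.towerLaw_perturbed_king_kron`), no U = 1 binder.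

WHAT THIS IS: the model-level resolution of the Δ1 «uniform slice constant on re-entrant unions» question — print's graded absorber (finest layer
outermost, [B9] (3.16)/(3.24)) has no hard wall near the carrier, and its tower converges at `L⁻¹` for ARBITRARY region geometry, whereas the
hard-wall members are slower ((√L)⁻¹ on boxes, `RegionBoxStarTowerEnd`) or refuted with one constant (`DirichletStarSlabMode`, checkerboards).
WHAT IT IS NOT: [B9] (3.23)–(3.27) as printed (print has `m = k` layers on `L^jη`-blocks decoupled by (3.42)-type decay — here `m` is FIXED and the
constants grow like `L^{3m}` — and a background field `U`; dictionary B0 asserted nowhere); NOT NE2 (U1a), which stays OPEN and ONE label in the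
count; spine PROVED 0/9 unchanged; NOT continuum YM, NOT infinite volume / mass gap / Clay.  HONEST DEPENDENCY: continuum YM on T⁴ ⇐ BetaPertH ∧
nine spine estimates (0/9 proved); BetaPertH ⇐ (D1) ∧ (D4) ∧ CAP+tail; G-an2-4 gates asym, D1 and NE2/3/4.  No `sorry`, no `def`.
-/

noncomputable section

open scoped BigOperators ComplexConjugate Matrix Matrix.Norms.L2Operator

namespace Summit.QuantumFields.BalabanUV.T4Continuum.GradedWellTowerEnd

open Literature.MathematicalPhysics.QuantumFieldTheory.Balaban1983to89.B5Prop11Plancherel (Tor fine Cst Cst_nonneg)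
open Literature.MathematicalPhysics.QuantumFieldTheory.Balaban1983to89.B5G183RateUnitTower (lev lev_neZero)
open Summit.QuantumFields.BalabanUV.T4Continuum
open Summit.QuantumFields.BalabanUV.T4Continuum.CovariantAveragingTower (TowerLimitRate)
open Summit.QuantumFields.BalabanUV.T4Continuum.BackgroundResolventTower
open Summit.QuantumFields.BalabanUV.T4Continuum.BalabanAveragedTowerUnit (idx Qlev)
open Summit.QuantumFields.BalabanUV.T4Continuum.SubtypeCompression (Coercive)
open Summit.QuantumFields.BalabanUV.T4Continuum.KingPairingPlantedLaw (JpcT calDalev)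
open Summit.QuantumFields.BalabanUV.T4Continuum.GradedWellData
open Summit.QuantumFields.BalabanUV.T4Continuum.GradedWellTorusTransfer (EGW)
open Summit.QuantumFields.BalabanUV.T4Continuum.GradedWellScalarCoercive (gamGW gamGW_pos)
open Summit.QuantumFields.BalabanUV.T4Continuum.GradedWellGram (sigGW)
open Summit.QuantumFields.BalabanUV.T4Continuum.GradedWellConsistencyTransfer (MGW SGW C1Tc C2GW cons_EGW_tower
  freeTowerLaws_GW_of_torus_cons towerLimitRate_GW_of_torus_cons towerLimitRate_GW_perturbed_cons)
open Summit.QuantumFields.BalabanUV.T4Continuum.GradedWellSandwichLaw (CSGW hSc_of_GWB)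
open Summit.QuantumFields.BalabanUV.T4Continuum.GradedWellDifference (eGW eGW_nonneg opNorm_EGW_le)
open Summit.QuantumFields.BalabanUV.T4Continuum.GradedWellTowerCoercive (gamGWv gamGWv_pos hco_GW)
open Summit.QuantumFields.BalabanUV.T4Continuum.GradedWellMassCommutator (CMGW CMGW_nonneg hMc_GW)
open Summit.QuantumFields.BalabanUV.T4Continuum.GradedWellColumnsTwoLevel (CbGW CbGW_nonneg hB_GW)
open Summit.QuantumFields.BalabanUV.T4Continuum.OutputRateTowerSocket (TowerLaw)
open Summit.QuantumFields.BalabanUV.T4Continuum.OutputRateTowerInstance (pertTower towerLaw_perturbed)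

variable {d : ℕ} (L : ℕ) [NeZero L] (M : Fin d → ℕ) [hM : ∀ μ, NeZero (M μ)] (m : ℕ) (layer : Tor M → ℕ) (a a' : ℝ)

/-! ## §1 The (H-cons) leaf of the graded-well difference `E_GW`, with NO displayed binder -/

/-- **(GW-E) — THE 𝒢-SANDWICHED TWO-LEVEL LAW OF `E_GW = Δ_a − Δ_GW`** (`1 ≤ d`, `layer ≤ m`, `0 < a′`, `k ≥ m`):
`‖𝒢^{(k+1)}(E_{k+1}J_k − J_kE_k)𝒢^{(k)}‖ ≤ C2GW(…)·L^{−k}` — leaf-06-g8's split `cons_EGW_tower` with BOTH remaining inputs now THEOREMS: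
the graded-mass law `hMc` (`GradedWellMassCommutator.hMc_GW`, (E4)) and the GW gauge-sandwich law `hSc` ⟸ (GW-B)
(`GradedWellSandwichLaw.hSc_of_GWB` ∘ `GradedWellColumnsTwoLevel.hB_GW`). [folklore] -/
theorem hEc_GW (ha : 0 < a) (hd : 1 ≤ d) (hlay : ∀ y, layer y ≤ m) (ha' : 0 < a') (k : ℕ) (hk : m ≤ k) :
    ‖(calDalev L M a ha (k + 1))⁻¹ * (EGW L M (k + 1) m layer a a' ha * JpcT L M k - JpcT L M k * EGW L M k m layer a a' ha)
        * (calDalev L M a ha k)⁻¹‖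
      ≤ C2GW d L a (Cst d a ^ 2 * CMGW L m) (Cst d a ^ 2 * CSGW d L m a' (CbGW d L m a')) * ((L : ℝ)⁻¹) ^ k :=
  cons_EGW_tower L M m layer a a' ha hd le_rfl (fun k hk => hMc_GW L M m layer a ha k hk)
    (hSc_of_GWB L M m layer a a' ha hd hlay ha' le_rfl (CbGW_nonneg (d := d) L m a' ha')
      (fun k hk => hB_GW L M k m layer a' hk hlay ha')) k hk

/-- the same at any rate `θ ≥ L⁻¹`. [folklore] -/
theorem hEc_GW_of_le (ha : 0 < a) (hd : 1 ≤ d) (hlay : ∀ y, layer y ≤ m) (ha' : 0 < a') {θ : ℝ} (hθ : (L : ℝ)⁻¹ ≤ θ)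
    (k : ℕ) (hk : m ≤ k) :
    ‖(calDalev L M a ha (k + 1))⁻¹ * (EGW L M (k + 1) m layer a a' ha * JpcT L M k - JpcT L M k * EGW L M k m layer a a' ha)
        * (calDalev L M a ha k)⁻¹‖
      ≤ C2GW d L a (Cst d a ^ 2 * CMGW L m) (Cst d a ^ 2 * CSGW d L m a' (CbGW d L m a')) * θ ^ k := by
  refine (hEc_GW L M m layer a a' ha hd hlay ha' k hk).trans (mul_le_mul_of_nonneg_left
    (pow_le_pow_left₀ (inv_nonneg.mpr (Nat.cast_nonneg L)) hθ k) ?_)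
  have h := hEc_GW L M m layer a a' ha hd hlay ha' m le_rfl
  have hLm : 0 < ((L : ℝ)⁻¹) ^ m := pow_pos (inv_pos.mpr (by exact_mod_cast Nat.pos_of_ne_zero (NeZero.ne L))) m
  exact nonneg_of_mul_nonneg_left ((norm_nonneg _).trans h) hLm

/-! ## §2 THE GRADED-WELL TOWER END — no displayed binder beyond `1 ≤ d`, `2 ≤ L`, `layer ≤ m`, `0 < a`, `0 < a′` -/

omit [NeZero L] in
/-- `L⁻¹ < 1` for `L ≥ 2`. [folklore] -/
theorem inv_lt_one_of_two_le (hL : 2 ≤ L) : ((L : ℝ))⁻¹ < 1 :=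
  inv_lt_one_of_one_lt₀ (by exact_mod_cast lt_of_lt_of_le one_lt_two hL)

/-- **THE GRADED-WELL TOWER CONVERGES AT THE TORUS RATE `L⁻¹`, UNCONDITIONALLY AT MODEL LEVEL** (`1 ≤ d`, `2 ≤ L`, `layer ≤ m`, `0 < a`,
`0 < a′`; ANY layer map `layer : Tor M → ℕ`): the King-averaged images of the graded-well propagators `G_GW(m+k) = (regionGW …)⁻¹` — print's
graded absorber (finest layer outermost) for an ARBITRARY region geometry, typed on the torus — converge with rate `L⁻¹` and constants depending on
`d, L, m, a, a′` only.  Every binder of the END of record `GradedWellSandwichLaw.towerLimitRate_GW_of_GWB` is a theorem: `hco` (GW-W1 + GW-S0,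
`GradedWellTowerCoercive.hco_GW`), `hE` (`GradedWellDifference.opNorm_EGW_le`), `hMc` ((E4), `GradedWellMassCommutator.hMc_GW`), `hB` ((GW-B),
`GradedWellColumnsTwoLevel.hB_GW`).  MODEL LEVEL (`U = 1`, one layer map on unit blocks, `m` fixed — constants grow like `L^{3m}`, finite torus,
operator norm); NOT [B9] (3.16)/(3.23)–(3.27)/(3.42) as printed (print has `m = k` layers on `L^jη`-blocks, decoupled by (3.42)-type decay, and a
background field); NE2 (U1a) is NOT proved by this; spine PROVED 0/9 unchanged. [cite: King1986, Lemma 4.5 (4.38) p.674 (shape: rate L^{−k});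
Balaban1985BackgroundPropagators, (3.16) p.393, (3.23)–(3.27) pp.394–395 (shapes: the graded absorber)] [folklore] -/
theorem towerLimitRate_GW (ha : 0 < a) (hd : 1 ≤ d) (hL : 2 ≤ L) (hlay : ∀ y, layer y ≤ m) (ha' : 0 < a') :
    TowerLimitRate (ι := fun k => idx L M (m + k)) (fun k => Qlev L M (m + k)) ((L : ℝ) ^ d)
      (fun k => (regionGW L M (m + k) m layer a a')⁻¹)
      (Cpert 0 ((1 + (gamGWv d L m a a')⁻¹ * eGW d L m a a') * (2 * d * Cst d a) * ((L : ℝ)⁻¹) ^ m)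
        (C1Tc d a (gamGWv d L m a a') (eGW d L m a a')
          (C2GW d L a (Cst d a ^ 2 * CMGW L m) (Cst d a ^ 2 * CSGW d L m a' (CbGW d L m a'))) * ((L : ℝ)⁻¹) ^ m) 0 0 0)
      ((L : ℝ)⁻¹) :=
  towerLimitRate_GW_of_torus_cons L M m layer a a' ha (gamGWv_pos (d := d) L (m := m) a a' ha') (eGW_nonneg (d := d) L m a a' ha.le ha')
    le_rfl (inv_lt_one_of_two_le L hL) (hco_GW L M m layer a a' ha hL hlay ha')
    (fun k _ => opNorm_EGW_le L M m layer a a' ha hlay ha' k) (hEc_GW L M m layer a a' ha hd hlay ha')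

/-- **`FreeTowerLaws` FOR THE GRADED-WELL TOWER WITH NO DISPLAYED BINDER** — the `hfree` input of row NE5's W1 socket
(`OutputRateTowerInstance.towerLaw_perturbed` / `operatorRate_of_perturbed_floor`) for the graded-well tower re-based at level `m`:
the INTERFACE OFFER of sub-row Δ1 to node U3. [folklore] -/
theorem freeTowerLaws_GW (ha : 0 < a) (hd : 1 ≤ d) (hL : 2 ≤ L) (hlay : ∀ y, layer y ≤ m) (ha' : 0 < a') :
    FreeTowerLaws (ι := fun k => idx L M (m + k)) (fun k => regionGW L M (m + k) m layer a a') (fun k => Qlev L M (m + k))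
      (fun k => JpcT L M (m + k)) (fun _ => 0) ((L : ℝ) ^ d)
      (fun k => (1 + (gamGWv d L m a a')⁻¹ * eGW d L m a a') * (2 * d * Cst d a * ((L : ℝ)⁻¹) ^ (m + k)))
      (fun k => C1Tc d a (gamGWv d L m a a') (eGW d L m a a')
        (C2GW d L a (Cst d a ^ 2 * CMGW L m) (Cst d a ^ 2 * CSGW d L m a' (CbGW d L m a'))) * ((L : ℝ)⁻¹) ^ (m + k))
      (fun _ => 0) :=
  freeTowerLaws_GW_of_torus_cons L M m layer a a' ha (gamGWv_pos (d := d) L (m := m) a a' ha')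
    (eGW_nonneg (d := d) L m a a' ha.le ha') le_rfl (hco_GW L M m layer a a' ha hL hlay ha')
    (fun k _ => opNorm_EGW_le L M m layer a a' ha hlay ha' k) (hEc_GW L M m layer a a' ha hd hlay ha')

/-- **… AND AT ANY GEOMETRIC RATE `θ ∈ [L⁻¹, 1)`** (the spine's Cauchy sum accepts any `θ < 1`). [folklore] -/
theorem towerLimitRate_GW_rate (ha : 0 < a) (hd : 1 ≤ d) (hL : 2 ≤ L) (hlay : ∀ y, layer y ≤ m) (ha' : 0 < a') {θ : ℝ} (hθ : (L : ℝ)⁻¹ ≤ θ)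
    (hθ1 : θ < 1) :
    TowerLimitRate (ι := fun k => idx L M (m + k)) (fun k => Qlev L M (m + k)) ((L : ℝ) ^ d)
      (fun k => (regionGW L M (m + k) m layer a a')⁻¹)
      (Cpert 0 ((1 + (gamGWv d L m a a')⁻¹ * eGW d L m a a') * (2 * d * Cst d a) * θ ^ m)
        (C1Tc d a (gamGWv d L m a a') (eGW d L m a a')
          (C2GW d L a (Cst d a ^ 2 * CMGW L m) (Cst d a ^ 2 * CSGW d L m a' (CbGW d L m a'))) * θ ^ m) 0 0 0) θ :=
  towerLimitRate_GW_of_torus_cons L M m layer a a' ha (gamGWv_pos (d := d) L (m := m) a a' ha') (eGW_nonneg (d := d) L m a a' ha.le ha')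
    hθ hθ1 (hco_GW L M m layer a a' ha hL hlay ha')
    (fun k _ => opNorm_EGW_le L M m layer a a' ha hlay ha' k) (hEc_GW_of_le L M m layer a a' ha hd hlay ha' hθ)

/-- **… AND FOR ANY PERTURBATION FAMILY ON THE GRADED-WELL TOWER** (`PerturbationLaws` with ONE `κ` and defects `C₂′·L^{−k}`, `‖t‖κ < 1`):
the resolvent route verbatim over the graded well — the socket into which a background perturbation `P_B(U)` restricted to the graded geometry
would be plugged (tiers B2–B7 over the graded carriers; NOT done here). [folklore] -/
theorem towerLimitRate_GW_perturbed (ha : 0 < a) (hd : 1 ≤ d) (hL : 2 ≤ L) (hlay : ∀ y, layer y ≤ m) (ha' : 0 < a')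
    {P : (k : ℕ) → Matrix (idx L M (m + k)) (idx L M (m + k)) ℂ} {κ C₂' : ℝ}
    (hpert : PerturbationLaws (ι := fun k => idx L M (m + k)) (fun k => regionGW L M (m + k) m layer a a') P
      (fun k => JpcT L M (m + k)) κ (fun k => C₂' * ((L : ℝ)⁻¹) ^ k)) {t : ℂ} (ht : ‖t‖ * κ < 1) :
    TowerLimitRate (ι := fun k => idx L M (m + k)) (fun k => Qlev L M (m + k)) ((L : ℝ) ^ d)
      (fun k => (regionGW L M (m + k) m layer a a' + t • P k)⁻¹)
      (Cpert κ ((1 + (gamGWv d L m a a')⁻¹ * eGW d L m a a') * (2 * d * Cst d a) * ((L : ℝ)⁻¹) ^ m)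
        (C1Tc d a (gamGWv d L m a a') (eGW d L m a a')
          (C2GW d L a (Cst d a ^ 2 * CMGW L m) (Cst d a ^ 2 * CSGW d L m a' (CbGW d L m a'))) * ((L : ℝ)⁻¹) ^ m) C₂' 0 t)
      ((L : ℝ)⁻¹) :=
  towerLimitRate_GW_perturbed_cons L M m layer a a' ha (gamGWv_pos (d := d) L (m := m) a a' ha')
    (eGW_nonneg (d := d) L m a a' ha.le ha') le_rfl (inv_lt_one_of_two_le L hL) (hco_GW L M m layer a a' ha hL hlay ha')
    (fun k _ => opNorm_EGW_le L M m layer a a' ha hlay ha' k) (hEc_GW L M m layer a a' ha hd hlay ha') hpert ht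

/-! ## §3 The graded-well tower in node NE5's W1 socket -/

/-- **THE GRADED-WELL TOWER IN NODE NE5's W1 SOCKET** (`OutputRateTowerSocket.TowerLaw`, row NE5's L12 carrier law): for ANY family `P j` of
perturbations obeying row NE2's `PerturbationLaws` against the graded-well tower with ONE `κ` and defects `C₂′·L^{−k}`, and `‖t‖κ < 1`,
`TowerLaw (fun _ => Qlev (m+·)) (pertTower G_GW⁻¹… P t) L^d (Cpert κ C₀ C₁ C₂′ 0 t) L⁻¹` — `OutputRateTowerInstance.towerLaw_perturbed` with
`hfree := freeTowerLaws_GW` (NO displayed U = 1 binder); the Δ1 analogue of the B7 × NE5 junction `OutputRateTowerBalaban.towerLaw_perturbed_king_kron`.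
[folklore] -/
theorem towerLaw_GW_perturbed (ha : 0 < a) (hd : 1 ≤ d) (hL : 2 ≤ L) (hlay : ∀ y, layer y ≤ m) (ha' : 0 < a')
    {Jx : Type*} {P : Jx → (k : ℕ) → Matrix (idx L M (m + k)) (idx L M (m + k)) ℂ} {κ C₂' : ℝ}
    (hpert : ∀ j, PerturbationLaws (ι := fun k => idx L M (m + k)) (fun k => regionGW L M (m + k) m layer a a') (P j)
      (fun k => JpcT L M (m + k)) κ (fun k => C₂' * ((L : ℝ)⁻¹) ^ k)) {t : ℂ} (ht : ‖t‖ * κ < 1) :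
    TowerLaw (fun _ : Jx => fun k => Qlev L M (m + k))
      (pertTower (ι := fun k => idx L M (m + k)) (fun k => regionGW L M (m + k) m layer a a') P t) ((L : ℝ) ^ d)
      (Cpert κ ((1 + (gamGWv d L m a a')⁻¹ * eGW d L m a a') * (2 * d * Cst d a) * ((L : ℝ)⁻¹) ^ m)
        (C1Tc d a (gamGWv d L m a a') (eGW d L m a a')
          (C2GW d L a (Cst d a ^ 2 * CMGW L m) (Cst d a ^ 2 * CSGW d L m a' (CbGW d L m a'))) * ((L : ℝ)⁻¹) ^ m) C₂' 0 t)
      ((L : ℝ)⁻¹) := by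
  have hr : (0 : ℝ) < (L : ℝ) ^ d := pow_pos (by exact_mod_cast Nat.pos_of_ne_zero (NeZero.ne L)) d
  exact towerLaw_perturbed hr (freeTowerLaws_GW L M m layer a a' ha hd hL hlay ha') hpert
    (fun k => le_of_eq (by rw [pow_add]; ring)) (fun k => le_of_eq (by rw [pow_add]; ring)) (fun _ _ => le_rfl)
    (fun _ => by simp) ht

end Summit.QuantumFields.BalabanUV.T4Continuum.GradedWellTowerEnd

end
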